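import Summits.QuantumFields.YangMills.Theorems.UnitScaleTiltProp7CombTowerUnitaryOfSkew
import Summits.QuantumFields.YangMills.Theorems.UnitScaleTiltProp7FrameResponseCombSU2T3
import Summits.QuantumFields.YangMills.Theorems.UnitScaleTiltProp7TowerClosenessGeometric
import HarnessLib

/-!
# `UnitScaleTiltProp7CombTowerPertWindowsOfIn19T3` — F-8c-3b OF THE (n3)-comb (II) LANE (★routeR-w1 g9 PENS ROUND 5 ∕ 10:21:33Z: «THE PERTURBATION HALF OF THE LEVEL WINDOWS —
# the two-block sups `μ_j` of `Ũʲ − 1` at the member, `72μ_j ≤ 1`, from `In19` + the hP-free comb-tower rows»), **READ OFF `RegPr F n K ε₀ W` AND `In19 F n K δ W U₁ X` ALONE**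
(route `UnitScaleTilt`, crux K1 «MinimiserStabilityRegPr» stmt-QuantumFields-19200; (β) row `hMc`; def-free, count-neutral, `--supports stmt-QuantumFields-19200 --as helper`).
Cell `ym3-torus` (HUMAN RULING D-0037, YM ladder rung R3 — YM₃ on T³ is a rung, not d = 4, not infinite volume, not a mass gap, not Clay), width seat `ym3-torus-px17` (gen 5).

WHY.  The sourced comb tower's one-step `ℓ²` row ✓`Prop7CornerCombCovMassStep.sqrt_sum_cell_normSq_step_le(_level)` (F-7b-1, ★routeR-w4) displays the second-order source through a
TWO-BLOCK WINDOW LETTER `μ`: `hμ : ∀ z κ, (2d+2)·L·√M₂(L•z,κ) ≤ μ`, `M₂` the two-block mass of the level-`j` driving field `Ỹ_j = Ũʲ − 1` over the `L`-blocks at `L•z` and `L•z + L•e_κ`;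
the level induction ✓`Prop7CornerCombLevelInduction.sourced_line_le_geom(_sharp)` (F-7c-1, w5-19200) needs these windows GEOMETRIC FROM THE TOP, `μ_j ∝ ρ^{2(k₀−j)} = Lʲ·η`
(`η = L^{−(K−n)}`), and the source row ✓`Prop7CombWalkMassTwoBlock.norm_rem2_succ_sub_trueStep_le_twoBlock` (H-3a) needs `72·(2d+2)L·√M₂ ≤ 1`.  At the member all of this is
the SUP ROW of the hP-free comb tower (this seat's lineage ✓`Prop7CombTowerUnitaryOfSkew.comb_tower_mem_unitaryUnits_of_regPr`: `‖Ũʲ(z,κ) − 1‖ ≤ 390·Lʲ·e·η` for a bondwise-skew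
`A` with `‖A b‖ ≤ e·η`) read at `A := iX` with the windows of [Balaban1985Variational] (19) — `In19`'s first conjunct (`X` Hermitian traceless ⇒ `iX` skew) and third conjunct
(`‖X b‖ < δ·η`) — and the lane's radius convention `δ ≤ ε₀∕6` (✓G3 `hD_of_hMcomb_of_rem2Rows`: `ε₀ := (12B₁′+1)·e`, `δ := 2B₁′e`; ✓`regPr_mono`), `10⁷·L³·ε₀ ≤ 1` (F-8c-3a's display).

WHAT IS PROVED (ns `…Theorems.Prop7CombTowerPertWindowsOfIn19`; sorry-free):
* §1 (reals) `sqrt_sum_sum_add_le_of_le` (two-block arithmetic: every term `≤ S²` ⇒ `√(Σ_sΣ_ν(f+g)) ≤ √(2·|ι|·|κ|)·S`), `sqrt_six_cube_le` (`√(6L³) ≤ 3L²`);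
* §2 (T³ numerals; `Lʲη ≤ 1` is ✓`Prop7SymAvgTwSym.pow_mul_eta_le_one`, reused) `pow_mul_eta_eq_inv_pow` (`Lʲη = (L^{K−n−j})⁻¹`), ★`pert_windows_of_ten7` — from `10⁷L³ε₀ ≤ 1`, `0 ≤ δ ≤ ε₀∕6`: the
  tower's size windows AT `e = δ` (`exp(…)·(1 + …·δ) ≤ 2`, `2δ ≤ c₃`, `10⁶L²δ ≤ 1`) and the two-block window numeral `72·(9360·L³·δ) ≤ 1`;
* §3 (the member) ★★★`comb_tower_pert_rows_of_regPr_of_in19` — for `RegPr F n K ε₀ W`, `In19 F n K δ W U₁ X`, `δ ≤ ε₀∕6`, `10⁷L³ε₀ ≤ 1`, EVERY `j ≤ K − n`, with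
  `U₀♯ := pull (bgUnits F K W) (basePt F n K)`, `U₁♯ := pull (fun b ↦ expUnit (Complex.I • X b)) (basePt F n K)` (`hMc`'s letters): (U) `Ũʲ(z,κ) ∈ U(2)`; (S) `‖Ũʲ(z,κ) − 1‖ ≤ 390·(Lʲ·(δ·η))`;
  (M) F-7b-1's `hμ` letter VERBATIM at the driving field `Ỹ_j = ↑Ũʲ − 1`, for EVERY coarse index `N′`, `z`, `κ`:
  `(2d+2)·L·√(Σ_{s}Σ_ν(‖Ỹ_j(L•boxVec N′ z + boxVec L s, ν)‖² + ‖Ỹ_j(L•boxVec N′ z + L•e_κ + boxVec L s, ν)‖²)) ≤ μ_j := 9360·L³·(Lʲ·(δ·η))`; (W) `72·μ_j ≤ 1` and the pointwise H-3a window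
  `72·((2d+2)·L·√M₂) ≤ 1`; `mu_level_nonneg`, `mu_level_le` (`μ_j ≤ 9360L³δ`).
HONEST FRAMING.  Bookkeeping over this lineage's landed hP-free tower theorem and the cell's window numerals (S–M); the BACKGROUND half (plaquettes `a_j`, loops `α_j`, `δ_j`, `hbU`) is
★routeR-w1's F-8c-3a; nothing of F-8b∕F-8c-final∕`hMcomb`∕`hMcomb₂`∕(β)∕EX∕the crux is proved; rung R3, not Clay; the YM mass gap is NOT proved.
References: T. Bałaban, CMP 98 (1985) 17–51 [Balaban1985Averaging] ((42)–(43) pp.23–24, (69) p.29, Prop. 3 (122)–(126) p.36, (159)–(163) p.42); CMP 99 (1985) 75–102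
[Balaban1985RegularSpaces] (Prop. 7 (1.139)–(1.145) p.100); CMP 102 (1985) 277–309 [Balaban1985Variational] ((2) p.278, (19) p.281); CMP 109 (1987) 249–301 [Balaban1987RG1] ((0.4) p.253).
-/

set_option autoImplicit false

noncomputable section

open scoped BigOperators Matrix.Norms.L2Operator

namespace Summit.QuantumFields.YangMills.Theorems.Prop7CombTowerPertWindowsOfIn19

open NormedSpace
open Literature.MathematicalPhysics.QuantumFieldTheory.Balaban1983to89
open Literature.MathematicalPhysics.QuantumFieldTheory.Balaban1983to89.T3ContinuumYM3Torus
open T3PrintedRegularMinimiser (RegPr)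
open T3SectALandauChart (eta eta_pos bgUnits In19)
open B7Prop1Explicit renaming Site → LSite
open B7Prop1Explicit (e boxVec expUnit)
open B7Prop2Explicit (C0 c2' unitaryUnits)
open B7Prop3Flat (c3)
open B7Eq92Concrete (tildIter)
open B10Eq27TorusAxialLog (pull)
open Summit.QuantumFields.YangMills.Theorems.Prop7SPrint (basePt)
open Summit.QuantumFields.YangMills.Theorems.Prop7CombTowerUnitaryOfSkew (star_I_smul_eq_neg comb_tower_mem_unitaryUnits_of_regPr)
open Summit.QuantumFields.YangMills.Theorems.Prop7FrameResponseCombSU2 (windows_of_ten7 tower_windows_of_ten7)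
open Summit.QuantumFields.YangMills.Theorems.Prop7SymAvgTwSym (pow_mul_eta_le_one)

/-! ## §1 Two-block arithmetic -/

/-- **TWO-BLOCK ARITHMETIC**: if every term of the two-block mass is at most `S²`, then `√(Σ_sΣ_ν (f s ν + g s ν)) ≤ √(2·|ι|·|κ|)·S`. [cite: Balaban1985Averaging, (124)-(126) p.36] -/
theorem sqrt_sum_sum_add_le_of_le {ι κ : Type*} [Fintype ι] [Fintype κ] {f g : ι → κ → ℝ} {S : ℝ} (hS : 0 ≤ S)
    (hf : ∀ s ν, f s ν ≤ S ^ 2) (hg : ∀ s ν, g s ν ≤ S ^ 2) :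
    Real.sqrt (∑ s, ∑ ν, (f s ν + g s ν)) ≤ Real.sqrt (2 * Fintype.card ι * Fintype.card κ) * S := by
  have hterm : ∑ s, ∑ ν, (f s ν + g s ν) ≤ ∑ _s : ι, ∑ _ν : κ, 2 * S ^ 2 :=
    Finset.sum_le_sum fun s _ => Finset.sum_le_sum fun ν _ => by linarith [hf s ν, hg s ν]
  have hcount : (∑ _s : ι, ∑ _ν : κ, 2 * S ^ 2 : ℝ) = (2 * Fintype.card ι * Fintype.card κ) * S ^ 2 := by
    simp only [Finset.sum_const, Finset.card_univ, nsmul_eq_mul]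
    ring
  rw [hcount] at hterm
  calc Real.sqrt (∑ s, ∑ ν, (f s ν + g s ν)) ≤ Real.sqrt ((2 * Fintype.card ι * Fintype.card κ) * S ^ 2) := Real.sqrt_le_sqrt hterm
    _ = Real.sqrt (2 * Fintype.card ι * Fintype.card κ) * S := by
        rw [Real.sqrt_mul (by positivity), Real.sqrt_sq hS]

/-- `√(6L³) ≤ 3L²` for `L ≥ 1` (`6L³ ≤ 9L⁴`). [cite: Balaban1985Averaging, (124)-(126) p.36] -/
theorem sqrt_six_cube_le {L : ℝ} (hL : 1 ≤ L) : Real.sqrt (6 * L ^ 3) ≤ 3 * L ^ 2 := by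
  have h0 : 0 ≤ 3 * L ^ 2 := by positivity
  have h1 : 6 * L ^ 3 ≤ (3 * L ^ 2) ^ 2 := by nlinarith [pow_pos (by linarith : (0 : ℝ) < L) 3]
  calc Real.sqrt (6 * L ^ 3) ≤ Real.sqrt ((3 * L ^ 2) ^ 2) := Real.sqrt_le_sqrt h1
    _ = 3 * L ^ 2 := Real.sqrt_sq h0

/-! ## §2 The T³ numerals: `Lʲη`, and the windows at `e = δ ≤ ε₀∕6` from `10⁷L³ε₀ ≤ 1` -/

section Numerals

variable (F : T3Family) (n K : ℕ)

/-- `Lʲ·η = (L^{K−n−j})⁻¹` for `j ≤ K − n` — the top-anchored letter `ρ^{2(k₀−j)}` of ✓`Prop7CornerCombLevelInduction` (`ρ² = L⁻¹`). [cite: Balaban1985Variational, (2) and (5) p.278] -/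
theorem pow_mul_eta_eq_inv_pow {j : ℕ} (hj : j ≤ K - n) : (F.L : ℝ) ^ j * eta F n K = ((F.L : ℝ) ^ (K - n - j))⁻¹ := by
  have hL0 : (F.L : ℝ) ≠ 0 := by have := F.hL.2; positivity
  have h : (F.L : ℝ) ^ (K - n) = (F.L : ℝ) ^ j * (F.L : ℝ) ^ (K - n - j) := by rw [← pow_add, Nat.add_sub_cancel' hj]
  rw [eta, inv_pow, ← div_eq_mul_inv, h, div_mul_eq_div_div, div_self (pow_ne_zero _ hL0), one_div]

/-- `0 ≤ Lʲ·η`. [cite: Balaban1985Variational, (5) p.278] -/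
theorem pow_mul_eta_nonneg (j : ℕ) : 0 ≤ (F.L : ℝ) ^ j * eta F n K := by
  have := eta_pos F n K
  positivity

/-- ★ **THE PERTURBATION WINDOWS AT `e = δ`** from the lane's two displayed smallnesses `10⁷·L³·ε₀ ≤ 1` and `δ ≤ ε₀∕6` (any sign of `δ`): the tower's exponential row at `δ` (lit ✓`B8Prop7AdmittedFamily`'s `hsmall`
letter, monotone in `e`; ✓`tower_windows_of_ten7` at `ε₀∕6`), `2δ ≤ c₃`, `10⁶·L²·δ ≤ 1`, and the two-block window numeral `72·(9360·L³·δ) ≤ 1` (`= 112320·L³·(6δ) ≤ 10⁷L³ε₀·(…)`).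
[cite: Balaban1985Averaging, Prop. 4 p.38, (131) p.38, (124)-(126) p.36; Balaban1985Variational, (19) p.281] -/
theorem pert_windows_of_ten7 {ε₀ δ : ℝ} (hε₀ : 0 ≤ ε₀) (hε : 10 ^ 7 * (F.L : ℝ) ^ 3 * ε₀ ≤ 1) (hδ : δ ≤ ε₀ / 6) :
    Real.exp (4 * (800 * (((F.P K).d : ℝ) + 1) ^ 2 * (((F.P K).d : ℝ) + 4)) * (2 * ε₀))
        * (1 + 8 * (131072 * (((F.P K).d : ℝ) + 1) ^ 2) * δ) ≤ 2 ∧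
      2 * δ ≤ c3 (F.P K).d (F.P K).L ∧ 10 ^ 6 * (F.L : ℝ) ^ 2 * δ ≤ 1 ∧ 72 * (9360 * (F.L : ℝ) ^ 3 * δ) ≤ 1 := by
  obtain ⟨hsmall, hc₃, -⟩ := tower_windows_of_ten7 F (K := K) hε₀ hε
  have hL3 : (3 : ℝ) ≤ F.L := by
    have h3 : 3 ≤ F.L := by obtain ⟨a, ha⟩ := F.hL.1; have := F.hL.2; omega
    exact_mod_cast h3
  refine ⟨?_, le_trans (by linarith) hc₃, ?_, ?_⟩
  · refine le_trans ?_ hsmall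
    apply mul_le_mul_of_nonneg_left _ (Real.exp_pos _).le
    have hK : (0 : ℝ) ≤ 8 * (131072 * (((F.P K).d : ℝ) + 1) ^ 2) := by positivity
    linarith [mul_le_mul_of_nonneg_left hδ hK]
  · -- `10⁶L²δ ≤ 10⁶L²ε₀∕6 ≤ 10⁷L³ε₀`
    have h1 : 10 ^ 6 * (F.L : ℝ) ^ 2 * δ ≤ 10 ^ 6 * (F.L : ℝ) ^ 2 * (ε₀ / 6) := mul_le_mul_of_nonneg_left hδ (by positivity)
    have h2 : 10 ^ 6 * (F.L : ℝ) ^ 2 * (ε₀ / 6) ≤ 10 ^ 7 * (F.L : ℝ) ^ 3 * ε₀ := by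
      nlinarith [mul_nonneg (mul_nonneg (by norm_num : (0:ℝ) ≤ 10 ^ 6) (sq_nonneg (F.L : ℝ))) hε₀]
    linarith
  · -- `72·9360·L³·δ ≤ 112320·L³·ε₀ ≤ 10⁷L³ε₀`
    have h1 : 72 * (9360 * (F.L : ℝ) ^ 3 * δ) ≤ 72 * (9360 * (F.L : ℝ) ^ 3 * (ε₀ / 6)) := by
      have : 0 ≤ (F.L : ℝ) ^ 3 := by positivity
      nlinarith [mul_le_mul_of_nonneg_left hδ this]
    have h2 : 72 * (9360 * (F.L : ℝ) ^ 3 * (ε₀ / 6)) ≤ 10 ^ 7 * (F.L : ℝ) ^ 3 * ε₀ := by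
      have : 0 ≤ (F.L : ℝ) ^ 3 * ε₀ := by positivity
      nlinarith
    linarith

end Numerals

/-! ## §3 ★★★ The member: the perturbation rows of `hMc`'s comb tower, per level, from `RegPr` + `In19` -/

section Member

variable (F : T3Family) {n K : ℕ}

/-- ★★★ **THE PERTURBATION HALF OF THE LEVEL WINDOWS OF `hMc`'s COMB TOWER.**  For `W ∈ 𝔘_k(ε₀)` (`RegPr F n K ε₀ W`, `10⁷L³ε₀ ≤ 1`) and `X` in (19)'s window `In19 F n K δ W U₁ X` with the
lane's radius convention `0 ≤ δ ≤ ε₀∕6`, at EVERY level `j ≤ K − n`, with `U₀♯ := pull (bgUnits F K W) (basePt F n K)`, `U₁♯ := pull (fun b ↦ expUnit (Complex.I • X b)) (basePt F n K)`,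
`Ũʲ := tildIter (F.P K).L U₀♯ U₁♯ j`, `η = eta F n K`:
(U) `Ũʲ(z,κ) ∈ U(2)`; (S) `‖↑Ũʲ(z,κ) − 1‖ ≤ 390·(Lʲ·(δ·η))`; (M) for every coarse index `N′` and every `z`, `κ` — ✓F-7b-1 `sqrt_sum_cell_normSq_step_le`'s `hμ` letter at `Y := Ũʲ − 1` —
`(2d+2)·L·√(Σ_{s : Fin d → Fin L}Σ_ν (‖↑Ũʲ(L•boxVec N′ z + boxVec L s, ν) − 1‖² + ‖↑Ũʲ(L•boxVec N′ z + L•e_κ + boxVec L s, ν) − 1‖²)) ≤ 9360·L³·(Lʲ·(δ·η))`; (W) the same quantity times `72`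
is `≤ 1` (✓H-3a's `hm72` letter) and `72·(9360·L³·(Lʲ·(δ·η))) ≤ 1`.
[cite: Balaban1985Averaging, (42)-(43) pp.23-24, (69) p.29, Prop. 3 (122)-(126) p.36, (159)-(163) p.42; Balaban1985RegularSpaces, Prop. 7 (1.139)-(1.145) p.100; Balaban1985Variational, (2) p.278, (19) p.281] -/
theorem comb_tower_pert_rows_of_regPr_of_in19 {ε₀ δ : ℝ} (hε₀ : 0 < ε₀) (hε : 10 ^ 7 * (F.L : ℝ) ^ 3 * ε₀ ≤ 1)
    {W U₁ : GaugeField (F.P K) 0 (Matrix.specialUnitaryGroup (Fin 2) ℂ)} (hreg : RegPr F n K ε₀ W)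
    {X : PBond (F.P K) 0 → Matrix (Fin 2) (Fin 2) ℂ} (hδ0 : 0 ≤ δ) (hδ : δ ≤ ε₀ / 6) (h19 : In19 F n K δ W U₁ X) :
    ∀ j ≤ K - n,
      (∀ (z : LSite (F.P K).d) (κ : Fin (F.P K).d),
          tildIter (F.P K).L (pull (bgUnits F K W) (basePt F n K)) (pull (fun b => expUnit (Complex.I • X b)) (basePt F n K)) j z κ
            ∈ unitaryUnits (Matrix (Fin 2) (Fin 2) ℂ)) ∧
      (∀ (z : LSite (F.P K).d) (κ : Fin (F.P K).d),
          ‖((tildIter (F.P K).L (pull (bgUnits F K W) (basePt F n K)) (pull (fun b => expUnit (Complex.I • X b)) (basePt F n K)) j z κ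
              : (Matrix (Fin 2) (Fin 2) ℂ)ˣ) : Matrix (Fin 2) (Fin 2) ℂ) - 1‖ ≤ 390 * ((F.L : ℝ) ^ j * (δ * eta F n K))) ∧
      (∀ (N' : ℕ) (z : Fin (F.P K).d → Fin N') (κ : Fin (F.P K).d),
          (2 * ((F.P K).d : ℝ) + 2) * ((F.P K).L : ℝ) * Real.sqrt (∑ s : Fin (F.P K).d → Fin (F.P K).L, ∑ ν : Fin (F.P K).d,
            (‖((tildIter (F.P K).L (pull (bgUnits F K W) (basePt F n K)) (pull (fun b => expUnit (Complex.I • X b)) (basePt F n K)) j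
                  (((F.P K).L : ℤ) • boxVec N' z + boxVec (F.P K).L s) ν : (Matrix (Fin 2) (Fin 2) ℂ)ˣ) : Matrix (Fin 2) (Fin 2) ℂ) - 1‖ ^ 2
              + ‖((tildIter (F.P K).L (pull (bgUnits F K W) (basePt F n K)) (pull (fun b => expUnit (Complex.I • X b)) (basePt F n K)) j
                  (((F.P K).L : ℤ) • boxVec N' z + ((F.P K).L : ℤ) • e κ + boxVec (F.P K).L s) ν : (Matrix (Fin 2) (Fin 2) ℂ)ˣ) : Matrix (Fin 2) (Fin 2) ℂ) - 1‖ ^ 2))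
            ≤ 9360 * (F.L : ℝ) ^ 3 * ((F.L : ℝ) ^ j * (δ * eta F n K))) ∧
      (∀ (N' : ℕ) (z : Fin (F.P K).d → Fin N') (κ : Fin (F.P K).d),
          72 * ((2 * ((F.P K).d : ℝ) + 2) * ((F.P K).L : ℝ) * Real.sqrt (∑ s : Fin (F.P K).d → Fin (F.P K).L, ∑ ν : Fin (F.P K).d,
            (‖((tildIter (F.P K).L (pull (bgUnits F K W) (basePt F n K)) (pull (fun b => expUnit (Complex.I • X b)) (basePt F n K)) j
                  (((F.P K).L : ℤ) • boxVec N' z + boxVec (F.P K).L s) ν : (Matrix (Fin 2) (Fin 2) ℂ)ˣ) : Matrix (Fin 2) (Fin 2) ℂ) - 1‖ ^ 2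
              + ‖((tildIter (F.P K).L (pull (bgUnits F K W) (basePt F n K)) (pull (fun b => expUnit (Complex.I • X b)) (basePt F n K)) j
                  (((F.P K).L : ℤ) • boxVec N' z + ((F.P K).L : ℤ) • e κ + boxVec (F.P K).L s) ν : (Matrix (Fin 2) (Fin 2) ℂ)ˣ) : Matrix (Fin 2) (Fin 2) ℂ) - 1‖ ^ 2)))
            ≤ 1) ∧
      72 * (9360 * (F.L : ℝ) ^ 3 * ((F.L : ℝ) ^ j * (δ * eta F n K))) ≤ 1 := by
  -- the windows at `e = δ`
  obtain ⟨hα3, hα4, -, -, -⟩ := windows_of_ten7 F (K := K) hε₀.le hε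
  obtain ⟨hsmall, hc₃, he6, h72⟩ := pert_windows_of_ten7 F K hε₀.le hε hδ
  -- `A := iX` is skew and `η`-small by `In19`
  have hX := h19.1
  have hA : ∀ b : PBond (F.P K) 0, ‖Complex.I • X b‖ ≤ δ * eta F n K := fun b => by
    rw [norm_smul, Complex.norm_I, one_mul]; exact (h19.2.2.1 b).le
  have hAs : ∀ b : PBond (F.P K) 0, star (Complex.I • X b) = -(Complex.I • X b) := fun b => star_I_smul_eq_neg (hX b).1
  have htower := comb_tower_mem_unitaryUnits_of_regPr F hε₀ hδ0 hα3 hα4 hsmall hc₃ he6 W hreg (fun b => Complex.I • X b) hA hAs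
  -- numerals
  have hd3 : (F.P K).d = 3 := T3Family.P_d F K
  have hd3r : ((F.P K).d : ℝ) = 3 := by exact_mod_cast hd3
  have hLL : ((F.P K).L : ℝ) = F.L := rfl
  have hL1 : (1 : ℝ) ≤ F.L := by exact_mod_cast F.hL.2.le
  have hη : 0 < eta F n K := eta_pos F n K
  intro j hj
  obtain ⟨-, -, -, hU, hS⟩ := htower j hj
  have hSj : 0 ≤ 390 * ((F.L : ℝ) ^ j * (δ * eta F n K)) := by positivity
  have hLjη : (F.L : ℝ) ^ j * eta F n K ≤ 1 := pow_mul_eta_le_one F hj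
  -- (M): the two-block row from the sup row
  have hM : ∀ (N' : ℕ) (z : Fin (F.P K).d → Fin N') (κ : Fin (F.P K).d),
      (2 * ((F.P K).d : ℝ) + 2) * ((F.P K).L : ℝ) * Real.sqrt (∑ s : Fin (F.P K).d → Fin (F.P K).L, ∑ ν : Fin (F.P K).d,
        (‖((tildIter (F.P K).L (pull (bgUnits F K W) (basePt F n K)) (pull (fun b => expUnit (Complex.I • X b)) (basePt F n K)) j
              (((F.P K).L : ℤ) • boxVec N' z + boxVec (F.P K).L s) ν : (Matrix (Fin 2) (Fin 2) ℂ)ˣ) : Matrix (Fin 2) (Fin 2) ℂ) - 1‖ ^ 2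
          + ‖((tildIter (F.P K).L (pull (bgUnits F K W) (basePt F n K)) (pull (fun b => expUnit (Complex.I • X b)) (basePt F n K)) j
              (((F.P K).L : ℤ) • boxVec N' z + ((F.P K).L : ℤ) • e κ + boxVec (F.P K).L s) ν : (Matrix (Fin 2) (Fin 2) ℂ)ˣ) : Matrix (Fin 2) (Fin 2) ℂ) - 1‖ ^ 2))
        ≤ 9360 * (F.L : ℝ) ^ 3 * ((F.L : ℝ) ^ j * (δ * eta F n K)) := by
    intro N' z κ
    have hsq := sqrt_sum_sum_add_le_of_le (ι := Fin (F.P K).d → Fin (F.P K).L) (κ := Fin (F.P K).d) hSj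
      (f := fun s ν => ‖((tildIter (F.P K).L (pull (bgUnits F K W) (basePt F n K)) (pull (fun b => expUnit (Complex.I • X b)) (basePt F n K)) j
              (((F.P K).L : ℤ) • boxVec N' z + boxVec (F.P K).L s) ν : (Matrix (Fin 2) (Fin 2) ℂ)ˣ) : Matrix (Fin 2) (Fin 2) ℂ) - 1‖ ^ 2)
      (g := fun s ν => ‖((tildIter (F.P K).L (pull (bgUnits F K W) (basePt F n K)) (pull (fun b => expUnit (Complex.I • X b)) (basePt F n K)) j
              (((F.P K).L : ℤ) • boxVec N' z + ((F.P K).L : ℤ) • e κ + boxVec (F.P K).L s) ν : (Matrix (Fin 2) (Fin 2) ℂ)ˣ) : Matrix (Fin 2) (Fin 2) ℂ) - 1‖ ^ 2)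
      (fun s ν => pow_le_pow_left₀ (norm_nonneg _) (hS _ _) 2) (fun s ν => pow_le_pow_left₀ (norm_nonneg _) (hS _ _) 2)
    have hcard : (2 * (Fintype.card (Fin (F.P K).d → Fin (F.P K).L) : ℝ) * Fintype.card (Fin (F.P K).d)) = 6 * (F.L : ℝ) ^ 3 := by
      simp only [Fintype.card_fun, Fintype.card_fin, hd3]
      push_cast
      rw [hLL]; ring
    rw [hcard] at hsq
    have h6 := sqrt_six_cube_le hL1
    rw [hd3r, hLL]
    have h8L : (0 : ℝ) ≤ (2 * 3 + 2) * (F.L : ℝ) := by positivity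
    calc (2 * (3 : ℝ) + 2) * (F.L : ℝ) * Real.sqrt _ ≤ (2 * 3 + 2) * (F.L : ℝ) * (Real.sqrt (6 * (F.L : ℝ) ^ 3) * (390 * ((F.L : ℝ) ^ j * (δ * eta F n K)))) :=
          mul_le_mul_of_nonneg_left hsq h8L
      _ ≤ (2 * 3 + 2) * (F.L : ℝ) * (3 * (F.L : ℝ) ^ 2 * (390 * ((F.L : ℝ) ^ j * (δ * eta F n K)))) :=
          mul_le_mul_of_nonneg_left (mul_le_mul_of_nonneg_right h6 hSj) h8L
      _ = 9360 * (F.L : ℝ) ^ 3 * ((F.L : ℝ) ^ j * (δ * eta F n K)) := by ring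
  -- (W): `72·μ_j ≤ 72·9360L³δ ≤ 1`
  have hW : 72 * (9360 * (F.L : ℝ) ^ 3 * ((F.L : ℝ) ^ j * (δ * eta F n K))) ≤ 1 := by
    have h1 : (F.L : ℝ) ^ j * (δ * eta F n K) ≤ δ := by
      calc (F.L : ℝ) ^ j * (δ * eta F n K) = δ * ((F.L : ℝ) ^ j * eta F n K) := by ring
        _ ≤ δ * 1 := mul_le_mul_of_nonneg_left hLjη hδ0
        _ = δ := mul_one δ
    have h2 : 0 ≤ 72 * (9360 * (F.L : ℝ) ^ 3) := by positivity
    calc 72 * (9360 * (F.L : ℝ) ^ 3 * ((F.L : ℝ) ^ j * (δ * eta F n K))) = 72 * (9360 * (F.L : ℝ) ^ 3) * ((F.L : ℝ) ^ j * (δ * eta F n K)) := by ring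
      _ ≤ 72 * (9360 * (F.L : ℝ) ^ 3) * δ := mul_le_mul_of_nonneg_left h1 h2
      _ = 72 * (9360 * (F.L : ℝ) ^ 3 * δ) := by ring
      _ ≤ 1 := h72
  refine ⟨hU, hS, hM, fun N' z κ => ?_, hW⟩
  exact le_trans (mul_le_mul_of_nonneg_left (hM N' z κ) (by norm_num)) hW

/-- `0 ≤ μ_j`. [cite: Balaban1985Averaging, (124)-(126) p.36] -/
theorem mu_level_nonneg {δ : ℝ} (hδ0 : 0 ≤ δ) (j : ℕ) : 0 ≤ 9360 * (F.L : ℝ) ^ 3 * ((F.L : ℝ) ^ j * (δ * eta F n K)) := by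
  have := eta_pos F n K
  positivity

/-- `μ_j ≤ 9360·L³·δ` for `j ≤ K − n` (the level-uniform window; `Lʲη ≤ 1`). [cite: Balaban1985Averaging, (124)-(126) p.36; Balaban1985Variational, (5) p.278] -/
theorem mu_level_le {δ : ℝ} (hδ0 : 0 ≤ δ) {j : ℕ} (hj : j ≤ K - n) :
    9360 * (F.L : ℝ) ^ 3 * ((F.L : ℝ) ^ j * (δ * eta F n K)) ≤ 9360 * (F.L : ℝ) ^ 3 * δ := by
  have hLjη : (F.L : ℝ) ^ j * eta F n K ≤ 1 := pow_mul_eta_le_one F hj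
  have h1 : (F.L : ℝ) ^ j * (δ * eta F n K) ≤ δ := by
    calc (F.L : ℝ) ^ j * (δ * eta F n K) = δ * ((F.L : ℝ) ^ j * eta F n K) := by ring
      _ ≤ δ * 1 := mul_le_mul_of_nonneg_left hLjη hδ0
      _ = δ := mul_one δ
  exact mul_le_mul_of_nonneg_left h1 (by positivity)

/-- **`μ_j` IN THE TOP-ANCHORED LETTER**: `μ_j = 9360·L³·δ·(L^{K−n−j})⁻¹` (`j ≤ K − n`) — the `ρ^{2(k₀−j)}` decay ✓`Prop7CornerCombLevelInduction.sourced_line_le_geom` asks of the two-block sups.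
[cite: Balaban1985Averaging, Prop. 3 (122)-(126) p.36; Balaban1985Variational, (5) p.278] -/
theorem mu_level_eq_inv_pow {δ : ℝ} {j : ℕ} (hj : j ≤ K - n) :
    9360 * (F.L : ℝ) ^ 3 * ((F.L : ℝ) ^ j * (δ * eta F n K)) = 9360 * (F.L : ℝ) ^ 3 * δ * ((F.L : ℝ) ^ (K - n - j))⁻¹ := by
  rw [← pow_mul_eta_eq_inv_pow F n K hj]; ring

end Member

end Summit.QuantumFields.YangMills.Theorems.Prop7CombTowerPertWindowsOfIn19

end
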